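import Literature.AnabelianGeometry.AbsoluteAnabelian.AbsTopIII.Thm19KummerTower
import Literature.AnabelianGeometry.AbsoluteAnabelian.AbsTopIII.Thm19Evaluation
import HarnessLib

/-!
# [AbsTopIII] Thm. 1.9 (e): the levelwise DICTIONARY of a tower — points ↦ places, orders, values — as ONE
# successor structure (cell abc-iut GAP-LEDGER G-w5d213-3; tower side (e0)(e1), consumed forms (e2)(e3))

Mochizuki, *Topics in Absolute Anabelian Geometry III*, §1, Theorem 1.9 (e), manuscript p. 38 (lit key
`paper:url-5493eb38cbb7`): "the data of the form described in Proposition 1.3, (a), (b), (c), arising from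
the construction of (d) [cf. also the decomposition groups of (a), the isomorphisms of (b)]"; Prop. 1.3
p. 30: "(b) the set of [surjective] homomorphisms `V_X := {ord_x : K_X^× ↠ ℤ}_{x ∈ X(k)}` [so we have a
natural bijection `V_X ⥲ X(k)`] [...] (c) [...] the `f ∈ K_X^×` such that `f(x) = 1`".

Sub-DAG `plan/L4/SUBDAG-AbsTopIII-Thm19.md`, row Thm19.e.r11 (cell abc-iut; abc-iut-L4-lead RULING #4a:
"(e0)(e1) tower-side = d213 view").  Sequel of `Thm19KummerTower.lean` (`IntrinsicKummerModel.NFTower`,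
the tower of base fields / function fields of a directed system of NF-complements).  The closer
`thm19e_of_dictionary` (`Thm19eProofs.lean`, abc-iut-w5-d213) consumes, per system, a levelwise DICTIONARY
between the system's NF-points / cuspidal degrees / value-one classes and the places / orders / evaluations
of the genuine function field `K_{Z_NF}/k̄_NF`; THIS FILE packages that dictionary as ONE structure
`IntrinsicKummerModel.NFDictionary M S Ω` EXTENDING the tower — INTERFACE DATA (true at the intended
étale-`π₁` model; NOT a published prerequisite, NOT a named Prop fact; the per-curve laws (D)(E) of the
abc-iut-L4-t1 lineage's `NaturalKummerModel` and its base-change legs are to DERIVE the consumed forms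
(e2)(e3) along the tower):

* (e0) `K_{Z_NF}` is an algebraic function field of one variable over `k̄_NF` of the genus of `Z` — the
  `k̄_NF`-algebra structure is a PARAMETER (like `Ω`), the two properties are fields;
* (e1) the point dictionary `pointPlace : NFPointIndex S → X(k̄_NF)` (places of `K_{Z_NF}/k̄_NF`) with
  "`SamePoint` ⟺ same place" ("the decomposition groups of (a)") and surjectivity (the `k′` exhaust `k̄`);
* (e2) the order dictionary, TOWER form: for a regular unit `g` of level `j` representing `f ∈ K_{Z_NF}^×`
  (`fnEmb j g = nfEmb f`), `HasOrderAt (κ_{V_j}(g) in lim) x n ⟺ ord_{pointPlace x}(f) = n` (Prop. 1.6 (iii)'s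
  degree clause through the (b)-synchronization, transported along the tower);
* (e3) the value dictionary, TOWER form: `HasValueOneAt (κ_{V_j}(g) in lim) x ⟺ f(pointPlace x) = 1`
  (Prop. 1.8's `η|_x := s_x^* η` and Kummer-faithfulness).

Statements-first: the structure ONLY; the closer over it (`thm19e_of_dictionaryTower`) is the proof-only
sibling `Thm19KummerTowerDictionaryProofs.lean`.  No instance declared.  HONEST FRAMING: typed ≠ proved;
nothing here bears on [IUTchIII] Cor. 3.12.
-/

noncomputable section

open CategoryTheory
open scoped Classical

namespace Literature.AnabelianGeometry.AbsoluteAnabelian.AbsTopIII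

open Literature.NumberTheory.DiophantineGeometry
open Literature.NumberTheory.DiophantineGeometry.AlgFunctionField

universe u

namespace IntrinsicKummerModel

/-- **The dictionary of a tower** (Thm. 1.9 (e) over the data of (d)): a tower `NFTower M S Ω` together
with — for a given `k̄_NF`-algebra structure on `K_{Z_NF}` — the properties "algebraic function field of one
variable of the genus of `Z`" and the LEVELWISE identifications of the system's NF-points with the places
of `K_{Z_NF}/k̄_NF`, of cuspidal degrees (through THE (b)-synchronization) with orders, and of value-one
classes with "`f(x) = 1`".  Interface data (cell abc-iut GAP-LEDGER G-w5d213-3).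
[cite: MochizukiAbsTopIII2015, Thm 1.9 (e) p.38] -/
structure NFDictionary (M : IntrinsicKummerModel.{u}) {Z : M.Curve} {ι : Type u} [Preorder ι]
    (S : CurveModel.NFComplementSystem M.toCurveModel Z ι) (Ω : Type u) [Field Ω]
    [Algebra ↥(M.kbarNF Z) (M.NFFunctionField Z)] extends M.NFTower S Ω where
  /-- (e0) "`K_{Z_NF}` is the function field of the curve `Z_NF`": an algebraic function field of one
  variable over `k̄_NF` -/
  isAlgFunctionField : IsAlgFunctionField ↥(M.kbarNF Z) (M.NFFunctionField Z)
  /-- (e0) of the genus of `Z` (genus is invariant under the descent `Z ×_{k_Z} k̄ ⇝ Z_NF`) -/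
  genus_eq : genus ↥(M.kbarNF Z) (M.NFFunctionField Z) = M.genus Z
  /-- (e1) the point dictionary: an NF-point of a level, rational over its base field, names a point of
  `Z_NF(k̄_NF)` = a place of `K_{Z_NF}/k̄_NF` -/
  pointPlace : M.NFPointIndex S → PlaceOver ↥(M.kbarNF Z) (M.NFFunctionField Z)
  /-- (e1) "named by a common point/cusp at a deeper level" ⟺ the same place -/
  samePoint_iff : ∀ a b : M.NFPointIndex S, M.SamePoint S a b ↔ pointPlace a = pointPlace b
  /-- (e1) every place comes from an NF-point of some level (the `k′` exhaust `k̄`) -/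
  pointPlace_surjective : Function.Surjective pointPlace
  /-- (e2) the order dictionary along the tower: for a regular unit `g` of level `j` representing
  `f ∈ K_{Z_NF}^×`, the container class of `κ_{V_j}(g)` has order `n` at `x` iff `ord_{pointPlace x}(f) = n` -/
  hasOrderAt_iff : ∀ (j : ι) (g : M.regularUnits (S.V j)) (f : (M.NFFunctionField Z)ˣ),
    fnEmb j ((g : (M.FunctionField (S.V j))ˣ) : M.FunctionField (S.V j)) = nfEmb (f : M.NFFunctionField Z) →
    ∀ (x : M.NFPointIndex S) (n : ℤ),
      M.HasOrderAt S (M.kummerToContainer S j (Additive.ofMul g)) x n ↔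
        (pointPlace x).ord (f : M.NFFunctionField Z) = n
  /-- (e3) the value dictionary along the tower: the container class of `κ_{V_j}(g)` has value one at `x`
  iff `f(pointPlace x) = 1` -/
  hasValueOneAt_iff : ∀ (j : ι) (g : M.regularUnits (S.V j)) (f : (M.NFFunctionField Z)ˣ),
    fnEmb j ((g : (M.FunctionField (S.V j))ˣ) : M.FunctionField (S.V j)) = nfEmb (f : M.NFFunctionField Z) →
    ∀ x : M.NFPointIndex S,
      M.HasValueOneAt S (M.kummerToContainer S j (Additive.ofMul g)) x ↔ f ∈ unitsWithValueOne (pointPlace x)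

end IntrinsicKummerModel

end Literature.AnabelianGeometry.AbsoluteAnabelian.AbsTopIII
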